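import Summits.QuantumFields.BalabanUV.Beta.GAN24.WoodburyFibreTransport

/-!
# Beta / GAN24 / WoodburyFibreRelInv — the physical block of a gauge-fixed KKT inverse is the RELATIVE INVERSE of the gauge-FREE
# bordered matrix on the range of the slice projector (matrix form of the four `RelInv` rules)
# (gan24-p3 gen 4, part 2; BINDER-OWNERS row G-an2-4 ∕ (CONV-C), prover part P3; NOT IN PRINT — our proof attempt; census rows (a)∕V3∕V7)

HONEST FRAMING (page 1 of everything the β sub-cell writes): discharging `BetaPertH` makes Bałaban's UV stability UNCONDITIONAL — a
real constructive-QFT result; it is NOT the continuum limit and NOT the Clay problem.  HONEST DEPENDENCY (cell reorg 2026-08-19, verbatim):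
«continuum YM on T⁴ ⇐ BetaPertH ∧ nine spine estimates (0/9 proved); BetaPertH ⇐ (D1) ∧ (D4) ∧ CAP+tail; G-an2-4 gates asym, D1 and NE2/3/4.»
HONEST LABEL: this file discharges NOTHING of the K-slot (`GAN24.CombesThomas.ConvCK 3 Lc`, road P1) and instantiates 0 wall binders; every
declaration is `[folklore]` finite-dimensional linear algebra over `GAN24/WoodburyFibreTransport` (p203757) and p3's `PropagatorWoodburyFibre.kkt`;
nothing printed and nothing programme-internal is a hypothesis.

## What is proved
With `X := (kkt H (fromRows Q R))⁻¹` the kernel of a COMPLETE slice `R` of the residual gauge `D` (`H` Hermitian, `H·D = 0`, `Q·D = 0`,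
`R·D` a unit, the bordered matrix a unit), `A := physBlock X = [[Γ, ℋ], [ℋ♭, 𝒮]]` (gauge rows and columns dropped), `𝕄 := kkt H Q`
(the gauge-FREE, degenerate bordered matrix `[[H, Qᴴ], [Q, 0]]`) and `E := fromBlocks (proj R D) 0 0 1`:
* `physBlock_mul_kkt` **`A·𝕄 = E`** and `kkt_mul_physBlock` **`𝕄·A = fromBlocks (proj R D)ᴴ 0 0 1`** (relative inverse on both sides —
  the gauge multiplier `(lift R D)ᴴ·J` of the slice system is exactly what gauge-free stationarity misses: `H·A + Qᴴ·μ = (proj R D)ᴴ·J`);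
* `slice_fixed_blocks` (`Γ = P·Γ·Pᴴ`, `ℋ = P·ℋ`, `ℋ♭ = ℋ♭·Pᴴ`), `projBlock_mul_physBlock` **`E·A = A`**, `physBlock_mul_projBlockAdj`
  **`A·fromBlocks (proj R D)ᴴ 0 0 1 = A`**.
These are the matrix shape of the four rules `E∘A = A`, `A∘E = A`, `(A∘𝕄)∘E = E`, `(E∘𝕄)∘A = E` of the cell's
`Beta.ChartConjugationRelative.RelInv` (an2's row-D1 `hR` chain; their `j = 0` instance on the lattice objects is
`RelInvBorderedHessian.relInv_coDressKBmAt_KInvStep_zero`) — here for ANY complete slice of an abstract degenerate KKT system, with NO lattice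
object instantiated (that junction is an2's ∕ an4's programme: `Beta/RelInvTransport` p203720 transports the rules across DECIMATION;
`WoodburyFibreTransport.inv_kkt_eq_transport` transports the kernel across SLICES).  NOT BetaPertH, NOT continuum, NOT Clay.
-/

namespace Summit.QuantumFields.BalabanUV.Beta.GAN24.WoodburyFibreRelInv

open Matrix
open Summit.QuantumFields.BalabanUV.Beta.PropagatorWoodburyFibre (kkt)
open Summit.QuantumFields.BalabanUV.Beta.GAN24.WoodburyFibreTransport

variable {𝕜 : Type*} [Field 𝕜]
variable {n m g : Type*} [Fintype n] [Fintype m] [Fintype g] [DecidableEq n] [DecidableEq m] [DecidableEq g]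

/-! ## §1 The physical block and its action on block vectors -/

section Phys

/-- Every two-leg block vector is `Sum.elim` of its legs. [folklore] -/
theorem sumElim_legs₂ {α β δ : Type*} (v : α ⊕ β → δ) : Sum.elim (v ∘ Sum.inl) (v ∘ Sum.inr) = v :=
  Sum.elim_comp_inl_inr v

omit [Fintype n] [Fintype m] [Fintype g] [DecidableEq n] [DecidableEq m] [DecidableEq g] in
/-- The PHYSICAL BLOCK of a slice kernel `X` (legs `n ∣ m ⊕ g`): drop the gauge rows and columns —
`[[X₁₁, X₁₂ᵐ], [X₂₁ᵐ, X₂₂ᵐᵐ]] = [[Γ, ℋ], [ℋ♭, 𝒮]]`. [folklore] -/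
def physBlock (X : Matrix (n ⊕ (m ⊕ g)) (n ⊕ (m ⊕ g)) 𝕜) : Matrix (n ⊕ m) (n ⊕ m) 𝕜 :=
  fromBlocks X.toBlocks₁₁ X.toBlocks₁₂.toCols₁ X.toBlocks₂₁.toRows₁ X.toBlocks₂₂.toBlocks₁₁

omit [DecidableEq n] [DecidableEq m] [DecidableEq g] in
/-- The physical block on `(J, B)` = the field and hard-multiplier legs of `X·(J, B, 0)`. [folklore] -/
theorem physBlock_mulVec (X : Matrix (n ⊕ (m ⊕ g)) (n ⊕ (m ⊕ g)) 𝕜) (J : n → 𝕜) (B : m → 𝕜) :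
    physBlock X *ᵥ Sum.elim J B =
      Sum.elim ((X *ᵥ Sum.elim J (Sum.elim B 0)) ∘ Sum.inl) (((X *ᵥ Sum.elim J (Sum.elim B 0)) ∘ Sum.inr) ∘ Sum.inl) := by
  rw [mulVec_leg_field, mulVec_leg_multiplier, physBlock, fromBlocks_mulVec, Sum.elim_comp_inl, Sum.elim_comp_inr, mulVec_zero,
    mulVec_zero, add_zero, add_zero]

end Phys

/-! ## §2 The four relative-inverse rules -/

section Rules

variable [StarRing 𝕜] {H : Matrix n n 𝕜} {Q : Matrix m n 𝕜} {R : Matrix g n 𝕜} {D : Matrix n g 𝕜}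

omit [Fintype g] [DecidableEq n] [DecidableEq m] [DecidableEq g] in
/-- The gauge-free bordered matrix `kkt H Q = [[H, Qᴴ], [Q, 0]]` on a block vector `(A, μ)`: `(H·A + Qᴴ·μ, Q·A)`. [folklore] -/
theorem kkt_mulVec_sumElim₂ (H : Matrix n n 𝕜) (Q : Matrix m n 𝕜) (A : n → 𝕜) (μ : m → 𝕜) :
    kkt H Q *ᵥ Sum.elim A μ = Sum.elim (H *ᵥ A + Qᴴ *ᵥ μ) (Q *ᵥ A) := by
  rw [kkt, fromBlocks_mulVec, Sum.elim_comp_inl, Sum.elim_comp_inr, zero_mulVec, add_zero]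

/-- **RULE `A·𝕄 = E` (right relative inverse)**: `physBlock (kkt H [Q;R])⁻¹ · kkt H Q = fromBlocks (proj R D) 0 0 1` — on the field
leg the physical block inverts the gauge-FREE bordered matrix up to the slice projector, on the hard-multiplier leg exactly. [folklore] -/
theorem physBlock_mul_kkt (hHD : H * D = 0) (hQD : Q * D = 0) (hR : IsUnit (R * D)) (hK : IsUnit (kkt H (fromRows Q R))) :
    physBlock (kkt H (fromRows Q R))⁻¹ * kkt H Q = fromBlocks (proj R D) 0 0 1 := by
  refine Matrix.ext_iff_mulVec.mpr fun v => ?_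
  rw [← mulVec_mulVec, ← sumElim_legs₂ v, kkt_mulVec_sumElim₂, physBlock_mulVec, fromBlocks_mulVec, Sum.elim_comp_inl,
    Sum.elim_comp_inr, zero_mulVec, zero_mulVec, add_zero, zero_add, one_mulVec]
  set a := v ∘ Sum.inl
  set b := v ∘ Sum.inr
  have hu : kkt H (fromRows Q R) *ᵥ Sum.elim (proj R D *ᵥ a) (Sum.elim b 0) =
      Sum.elim (H *ᵥ a + Qᴴ *ᵥ b) (Sum.elim (Q *ᵥ a) 0) := by
    rw [kkt_mulVec_sumElim, mulVec_zero, add_zero, mulVec_mulVec, mulVec_mulVec, mulVec_mulVec, mul_proj_of_mul_D H hHD R,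
      mul_proj_of_mul_D Q hQD R, mul_proj hR, zero_mulVec]
  have hX : (kkt H (fromRows Q R))⁻¹ *ᵥ Sum.elim (H *ᵥ a + Qᴴ *ᵥ b) (Sum.elim (Q *ᵥ a) 0) =
      Sum.elim (proj R D *ᵥ a) (Sum.elim b 0) := by
    rw [← hu, mulVec_mulVec, nonsing_inv_mul _ ((isUnit_iff_isUnit_det _).mp hK), one_mulVec]
  rw [hX, Sum.elim_comp_inl, Sum.elim_comp_inr, Sum.elim_comp_inl]

/-- **RULE `𝕄·A = Eᴴ` (left relative inverse)**: `kkt H Q · physBlock (kkt H [Q;R])⁻¹ = fromBlocks (proj R D)ᴴ 0 0 1` — the gauge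
multiplier `(lift R D)ᴴ·J` of the slice system is exactly what gauge-free stationarity misses: `H·A + Qᴴ·μ = (proj R D)ᴴ·J`. [folklore] -/
theorem kkt_mul_physBlock (hH : Hᴴ = H) (hHD : H * D = 0) (hQD : Q * D = 0) (hR : IsUnit (R * D))
    (hK : IsUnit (kkt H (fromRows Q R))) :
    kkt H Q * physBlock (kkt H (fromRows Q R))⁻¹ = fromBlocks (proj R D)ᴴ 0 0 1 := by
  refine Matrix.ext_iff_mulVec.mpr fun v => ?_
  rw [← mulVec_mulVec, ← sumElim_legs₂ v, physBlock_mulVec, kkt_mulVec_sumElim₂, fromBlocks_mulVec, Sum.elim_comp_inl,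
    Sum.elim_comp_inr, zero_mulVec, zero_mulVec, add_zero, zero_add, one_mulVec]
  set J := v ∘ Sum.inl
  set B := v ∘ Sum.inr
  set X := (kkt H (fromRows Q R))⁻¹ with hXdef
  set w : n ⊕ (m ⊕ g) → 𝕜 := Sum.elim J (Sum.elim B 0) with hw
  have hsol : kkt H (fromRows Q R) *ᵥ
      Sum.elim ((X *ᵥ w) ∘ Sum.inl) (Sum.elim (((X *ᵥ w) ∘ Sum.inr) ∘ Sum.inl) (((X *ᵥ w) ∘ Sum.inr) ∘ Sum.inr)) = w := by
    rw [sumElim_legs, mulVec_mulVec, mul_nonsing_inv _ ((isUnit_iff_isUnit_det _).mp hK), one_mulVec]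
  rw [kkt_mulVec_sumElim, hw, Sum.elim_eq_iff, Sum.elim_eq_iff] at hsol
  obtain ⟨hs, hQ, -⟩ := hsol
  have hν : ((X *ᵥ w) ∘ Sum.inr) ∘ Sum.inr = (lift R D)ᴴ *ᵥ J := by
    have hT : X = transport R D X := inv_kkt_eq_transport_self hH hHD hQD hR hK
    conv_lhs => rw [hT, hw, transport_mulVec, Sum.elim_comp_inr, Sum.elim_comp_inr]
  rw [hν] at hs
  have hst : H *ᵥ ((X *ᵥ w) ∘ Sum.inl) + Qᴴ *ᵥ (((X *ᵥ w) ∘ Sum.inr) ∘ Sum.inl) = (proj R D)ᴴ *ᵥ J := by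
    rw [eq_sub_of_add_eq hs, proj, conjTranspose_sub, conjTranspose_one, conjTranspose_mul, sub_mulVec, one_mulVec, ← mulVec_mulVec]
  rw [hst, hQ]

/-- The three FIXED-POINT block identities of one slice kernel (`X = transport R D X`, `WoodburyFibreTransport.inv_kkt_eq_transport_self`):
`Γ = P·Γ·Pᴴ`, `ℋ = P·ℋ`, `ℋ♭ = ℋ♭·Pᴴ` (`P = proj R D`). [folklore] -/
theorem slice_fixed_blocks (hH : Hᴴ = H) (hHD : H * D = 0) (hQD : Q * D = 0) (hR : IsUnit (R * D))
    (hK : IsUnit (kkt H (fromRows Q R))) :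
    ((kkt H (fromRows Q R))⁻¹).toBlocks₁₁ = proj R D * ((kkt H (fromRows Q R))⁻¹).toBlocks₁₁ * (proj R D)ᴴ ∧
    ((kkt H (fromRows Q R))⁻¹).toBlocks₁₂.toCols₁ = proj R D * ((kkt H (fromRows Q R))⁻¹).toBlocks₁₂.toCols₁ ∧
    ((kkt H (fromRows Q R))⁻¹).toBlocks₂₁.toRows₁ = ((kkt H (fromRows Q R))⁻¹).toBlocks₂₁.toRows₁ * (proj R D)ᴴ := by
  have hT := inv_kkt_eq_transport_self hH hHD hQD hR hK
  refine ⟨?_, ?_, ?_⟩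
  · have h := congrArg Matrix.toBlocks₁₁ hT
    rwa [transport, toBlocks_fromBlocks₁₁] at h
  · have h := congrArg (fun Y => Y.toBlocks₁₂.toCols₁) hT
    simp only [transport, toBlocks_fromBlocks₁₂, toCols₁_fromCols] at h
    exact h
  · have h := congrArg (fun Y => Y.toBlocks₂₁.toRows₁) hT
    simp only [transport, toBlocks_fromBlocks₂₁, toRows₁_fromRows] at h
    exact h

/-- **RULE `E·A = A`**: the physical block lives on the slice in the OUTPUT field leg, `fromBlocks (proj R D) 0 0 1 · A = A`. [folklore] -/
theorem projBlock_mul_physBlock (hH : Hᴴ = H) (hHD : H * D = 0) (hQD : Q * D = 0) (hR : IsUnit (R * D))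
    (hK : IsUnit (kkt H (fromRows Q R))) :
    fromBlocks (proj R D) 0 0 (1 : Matrix m m 𝕜) * physBlock (kkt H (fromRows Q R))⁻¹ = physBlock (kkt H (fromRows Q R))⁻¹ := by
  obtain ⟨h11, h12, -⟩ := slice_fixed_blocks hH hHD hQD hR hK
  have hP11 : proj R D * ((kkt H (fromRows Q R))⁻¹).toBlocks₁₁ = ((kkt H (fromRows Q R))⁻¹).toBlocks₁₁ := by
    conv_lhs => rw [h11]
    rw [← Matrix.mul_assoc, ← Matrix.mul_assoc, proj_mul_proj_self hR, ← h11]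
  rw [physBlock, fromBlocks_multiply]
  simp only [Matrix.zero_mul, Matrix.one_mul, add_zero, zero_add]
  rw [hP11, ← h12]

/-- **RULE `A·Eᴴ = A`**: the physical block lives on the slice in the INPUT field leg, `A · fromBlocks (proj R D)ᴴ 0 0 1 = A`. [folklore] -/
theorem physBlock_mul_projBlockAdj (hH : Hᴴ = H) (hHD : H * D = 0) (hQD : Q * D = 0) (hR : IsUnit (R * D))
    (hK : IsUnit (kkt H (fromRows Q R))) :
    physBlock (kkt H (fromRows Q R))⁻¹ * fromBlocks (proj R D)ᴴ 0 0 (1 : Matrix m m 𝕜) = physBlock (kkt H (fromRows Q R))⁻¹ := by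
  obtain ⟨h11, -, h21⟩ := slice_fixed_blocks hH hHD hQD hR hK
  have hP11 : ((kkt H (fromRows Q R))⁻¹).toBlocks₁₁ * (proj R D)ᴴ = ((kkt H (fromRows Q R))⁻¹).toBlocks₁₁ := by
    conv_lhs => rw [h11]
    rw [Matrix.mul_assoc, ← conjTranspose_mul, proj_mul_proj_self hR, ← h11]
  rw [physBlock, fromBlocks_multiply]
  simp only [Matrix.mul_zero, Matrix.mul_one, add_zero, zero_add]
  rw [hP11, ← h21]

end Rules

end Summit.QuantumFields.BalabanUV.Beta.GAN24.WoodburyFibreRelInv
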